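import Literature.NumberTheory.Transcendental.NumCondEnvelopes
import Literature.NumberTheory.Transcendental.AuxiliaryFunctionSpaced
import HarnessLib

/-!
# Two-base envelopes for the numerical condition of the torsion case

Topic: `Literature/NumberTheory/Transcendental`. Plan item W4 (closing, torsion case, part 5a)
of the unit `provefact-Literature.NumberTheory.Transcendental.H-b596640137`. The envelopes of
`NumCondEnvelopes.lean` that involve the Siegel house bound are re-proved for the bound
`siegelHouseBound₃` of the spaced Siegel step (`AuxiliaryFunctionSpaced.lean`: `S_rows + 1`
rows at the points `(ℓ s₀)·v`, entry bound `houseBound D' T (ℓ S_rows)`), and the saving factor of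
the spaced zeros is bounded. PROVED: `siegelHouseBound₃_le`, `houseXi_le₃`, `lineValBound_le₃`
(conclusions with `A = houseBound D' T (ℓ S_rows)`), `saving_le₃`. The proofs are those of
`NumCondEnvelopes.lean` verbatim up to the bound fed in.

## References

* A. Baker, G. Wüstholz, *Logarithmic Forms and Diophantine Geometry*, CUP 2007, §6.8 (p. 119).
-/

noncomputable section

open Complex MvPolynomial Finset NumberField
open scoped PeriodPair

namespace Literature.NumberTheory.Transcendental

namespace GaGmE

namespace Std

namespace BakerData

variable {β γ δ : Type} [Fintype β] [Fintype γ] [Fintype δ] [DecidableEq γ]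
variable (B : BakerData β γ δ)

/-! ### The Siegel house bound of the spaced system -/

/-- **Envelope of the Siegel house bound of the spaced system** when `q ≥ 2p`:
`siegelHouseBound₃ ≤ G² · W^n · A`, `A = houseBound D' T (ℓ S_rows)`, given `D' + 1 ≤ W`. [folklore] -/
theorem siegelHouseBound₃_le (ℓ D' T Srows : ℕ) {W : ℝ} (hWD : (D' : ℝ) + 1 ≤ W)
    (hqp : 2 * ((Srows + 1) * T ^ B.dd) ≤ (D' + 1) ^ Fintype.card (β ⊕ (γ ⊕ δ)))
    (hp : 0 < (Srows + 1) * T ^ B.dd) :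
    B.siegelHouseBound₃ ℓ D' T Srows ≤
      B.bigConst ^ 2 * W ^ Fintype.card (β ⊕ (γ ⊕ δ)) * B.houseBound D' T (ℓ * Srows) := by
  obtain ⟨hG2, -, -, -, -, -, hCK, -⟩ := B.bigConst_spec
  set n := Fintype.card (β ⊕ (γ ⊕ δ)) with hn
  set p : ℕ := (Srows + 1) * T ^ B.dd with hp'
  set q : ℕ := (D' + 1) ^ n with hq
  have hA1 := B.one_le_houseBound D' T (ℓ * Srows)
  have hC1 := one_le_siegelConst B.K
  have hq1 : (1 : ℝ) ≤ q := by
    have : 1 ≤ q := Nat.one_le_iff_ne_zero.mpr (pow_ne_zero _ (Nat.succ_ne_zero _))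
    exact_mod_cast this
  have hqp' : (2 : ℝ) * p ≤ q := by exact_mod_cast hqp
  have hp0 : (0 : ℝ) < p := by exact_mod_cast hp
  set t : ℝ := (p : ℝ) / ((q : ℝ) - p) with ht
  have ht1 : t ≤ 1 := by rw [ht, div_le_one (by linarith)]; linarith
  have hbase : 1 ≤ siegelConst B.K * q * B.houseBound D' T (ℓ * Srows) :=
    one_le_mul_of_one_le_of_one_le (one_le_mul_of_one_le_of_one_le hC1 hq1) hA1
  unfold siegelHouseBound₃
  rw [← hn, ← hp', ← hq]
  calc siegelConst B.K * (siegelConst B.K * (q : ℝ) * B.houseBound D' T (ℓ * Srows)) ^ t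
      ≤ siegelConst B.K * (siegelConst B.K * (q : ℝ) * B.houseBound D' T (ℓ * Srows)) :=
        mul_le_mul_of_nonneg_left (rpow_le_self_of_one_le hbase ht1) (zero_le_one.trans hC1)
    _ = siegelConst B.K ^ 2 * (q : ℝ) * B.houseBound D' T (ℓ * Srows) := by ring
    _ ≤ B.bigConst ^ 2 * W ^ n * B.houseBound D' T (ℓ * Srows) := by
        have hqW : (q : ℝ) ≤ W ^ n := by
          rw [hq]; push_cast; exact pow_le_pow_left₀ (by positivity) hWD n
        have hCG : siegelConst B.K ^ 2 ≤ B.bigConst ^ 2 := pow_le_pow_left₀ (zero_le_one.trans hC1) hCK 2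
        have : (0 : ℝ) ≤ B.bigConst ^ 2 := by positivity
        exact mul_le_mul_of_nonneg_right (mul_le_mul hCG hqW (by positivity) this) (zero_le_one.trans hA1)

variable [DecidableEq β] [DecidableEq δ]

/-- **Envelope of `H_ξ`** under the Siegel house bound of the spaced system:
`H_ξ ≤ G³ · W^{2n} · A`, `A = houseBound D' T (ℓ S_rows)`. [folklore] -/
theorem houseXi_le₃ {ℓ D' T Srows : ℕ} (ξ : UIdx β γ δ D' → 𝓞 B.K)
    (hξ : ∀ u, house ((ξ u : 𝓞 B.K) : B.K) ≤ B.siegelHouseBound₃ ℓ D' T Srows) {W : ℝ} (hW1 : 1 ≤ W)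
    (hWD : (D' : ℝ) + 1 ≤ W) (hqp : 2 * ((Srows + 1) * T ^ B.dd) ≤ (D' + 1) ^ Fintype.card (β ⊕ (γ ⊕ δ)))
    (hp : 0 < (Srows + 1) * T ^ B.dd) :
    B.houseXi ξ ≤ B.bigConst ^ 3 * W ^ (2 * Fintype.card (β ⊕ (γ ⊕ δ))) * B.houseBound D' T (ℓ * Srows) := by
  have hG2 := B.bigConst_spec.1
  set n := Fintype.card (β ⊕ (γ ⊕ δ)) with hn
  set A := B.houseBound D' T (ℓ * Srows) with hA
  have hSHB := B.siegelHouseBound₃_le ℓ D' T Srows hWD hqp hp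
  rw [← hn] at hSHB
  have hA1 : 1 ≤ A := B.one_le_houseBound D' T (ℓ * Srows)
  have hU : (Fintype.card (UIdx β γ δ D') : ℝ) ≤ W ^ n := by
    rw [card_UIdx]; push_cast; exact pow_le_pow_left₀ (by positivity) hWD n
  unfold houseXi
  have hsum : ∑ u, house ((ξ u : 𝓞 B.K) : B.K) ≤ (Fintype.card (UIdx β γ δ D') : ℝ) * B.siegelHouseBound₃ ℓ D' T Srows := by
    calc ∑ u, house ((ξ u : 𝓞 B.K) : B.K) ≤ ∑ _u : UIdx β γ δ D', B.siegelHouseBound₃ ℓ D' T Srows :=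
          Finset.sum_le_sum fun u _ => hξ u
      _ = _ := by rw [Finset.sum_const, nsmul_eq_mul, Finset.card_univ]
  have hSHB0 : 0 ≤ B.siegelHouseBound₃ ℓ D' T Srows := (house_nonneg _).trans (hξ (fun _ => 0))
  have hWn : (1 : ℝ) ≤ W ^ n := one_le_pow₀ hW1
  have hX : 1 + (Fintype.card (UIdx β γ δ D') : ℝ) * B.siegelHouseBound₃ ℓ D' T Srows ≤
      W ^ n * (B.bigConst ^ 2 * W ^ n * A) + W ^ n * (B.bigConst ^ 2 * W ^ n * A) := by
    have h1 : (1 : ℝ) ≤ W ^ n * (B.bigConst ^ 2 * W ^ n * A) := by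
      refine one_le_mul_of_one_le_of_one_le hWn (one_le_mul_of_one_le_of_one_le
        (one_le_mul_of_one_le_of_one_le (by nlinarith) hWn) hA1)
    have h2 : (Fintype.card (UIdx β γ δ D') : ℝ) * B.siegelHouseBound₃ ℓ D' T Srows ≤
        W ^ n * (B.bigConst ^ 2 * W ^ n * A) :=
      mul_le_mul hU hSHB hSHB0 (by positivity)
    linarith
  calc 1 + ∑ u, house ((ξ u : 𝓞 B.K) : B.K) ≤ 1 + (Fintype.card (UIdx β γ δ D') : ℝ) * B.siegelHouseBound₃ ℓ D' T Srows := by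
        linarith
    _ ≤ 2 * (W ^ n * (B.bigConst ^ 2 * W ^ n * A)) := by linarith
    _ ≤ B.bigConst * (W ^ n * (B.bigConst ^ 2 * W ^ n * A)) :=
        mul_le_mul_of_nonneg_right hG2 (by positivity)
    _ = B.bigConst ^ 3 * W ^ (2 * n) * A := by ring

/-- **Envelope of `lineValBound`** under the Siegel house bound of the spaced system: for
`s ≤ S₁`, `k ≤ T'`, `Λ_{s,k} ≤ G^{2T' + 3 + D + (S₁+1)P₁} · W^{2T' + 3n + P₁} · A`,
`P₁ = D·hdeg + 2T'`, `A = houseBound D' T (ℓ S_rows)`. [folklore] -/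
theorem lineValBound_le₃ {ℓ D' T Srows S₁ T' : ℕ} (ξ : UIdx β γ δ D' → 𝓞 B.K)
    (hξ : ∀ u, house ((ξ u : 𝓞 B.K) : B.K) ≤ B.siegelHouseBound₃ ℓ D' T Srows) {W : ℝ} (hW1 : 1 ≤ W)
    (hWD : (D' : ℝ) + 1 ≤ W) (hqp : 2 * ((Srows + 1) * T ^ B.dd) ≤ (D' + 1) ^ Fintype.card (β ⊕ (γ ⊕ δ)))
    (hp : 0 < (Srows + 1) * T ^ B.dd) (hWT' : (T' : ℝ) ≤ W)
    (hWP : ((Fintype.card (β ⊕ (γ ⊕ δ)) * D' * B.hdeg : ℕ) : ℝ) + 2 * T' ≤ W) (hWS : (S₁ : ℝ) + 1 ≤ W)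
    {s k : ℕ} (hs : s ≤ S₁) (hk : k ≤ T') :
    B.lineValBound ξ s k ≤
      B.bigConst ^ (2 * T' + 3 + Fintype.card (β ⊕ (γ ⊕ δ)) * D' +
          (S₁ + 1) * (Fintype.card (β ⊕ (γ ⊕ δ)) * D' * B.hdeg + 2 * T')) *
        W ^ (2 * T' + 3 * Fintype.card (β ⊕ (γ ⊕ δ)) + (Fintype.card (β ⊕ (γ ⊕ δ)) * D' * B.hdeg + 2 * T')) *
        B.houseBound D' T (ℓ * Srows) := by
  obtain ⟨hG2, -, hM, hhB, hqB, hdd, -⟩ := B.bigConst_spec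
  have hG1 := B.one_le_bigConst
  have hG0 : (0 : ℝ) ≤ B.bigConst := by linarith
  have hW0 : (0 : ℝ) ≤ W := by linarith
  set n := Fintype.card (β ⊕ (γ ⊕ δ)) with hn
  set D := n * D' with hD
  set P₁ := D * B.hdeg + 2 * T' with hP₁
  set A := B.houseBound D' T (ℓ * Srows) with hA
  have hA1 : 1 ≤ A := B.one_le_houseBound D' T (ℓ * Srows)
  have hHξ := B.houseXi_le₃ ξ hξ hW1 hWD hqp hp
  rw [← hn, ← hA] at hHξ
  have hkW : (k : ℝ) ≤ W := le_trans (by exact_mod_cast hk) hWT'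
  have hU : (Fintype.card (UIdx β γ δ D') : ℝ) ≤ W ^ n := by
    rw [card_UIdx]; push_cast; exact pow_le_pow_left₀ (by positivity) hWD n
  -- the factors
  have f1 : (B.dd : ℝ) ^ k ≤ B.bigConst ^ T' :=
    (pow_le_pow_left₀ (Nat.cast_nonneg _) (by linarith : (B.dd : ℝ) ≤ B.bigConst) k).trans
      (pow_le_pow_right₀ hG1 hk)
  have f2 : (k : ℝ) ^ k ≤ W ^ T' := (pow_le_pow_left₀ (Nat.cast_nonneg _) hkW k).trans (pow_le_pow_right₀ hW1 hk)
  have f5 : (((D * B.hdeg : ℕ) : ℝ) + 2 * k) ^ k ≤ W ^ T' := by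
    have : ((D * B.hdeg : ℕ) : ℝ) + 2 * k ≤ W := by
      have : (k : ℝ) ≤ T' := by exact_mod_cast hk
      rw [hD]; linarith
    exact (pow_le_pow_left₀ (by positivity) this k).trans (pow_le_pow_right₀ hW1 hk)
  have f6 : B.qB ^ k ≤ B.bigConst ^ T' :=
    ((pow_le_pow_left₀ B.qB_nonneg ((le_max_right 1 B.qB).trans hqB) k)).trans (pow_le_pow_right₀ hG1 hk)
  have f7 : B.hB ^ D ≤ B.bigConst ^ D := pow_le_pow_left₀ (zero_le_one.trans B.one_le_hB) hhB _
  have hsM1 : (1 : ℝ) ≤ ((s : ℝ) + 1) * B.M ^ (s + 1) :=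
    one_le_mul_of_one_le_of_one_le (by have : (0:ℝ) ≤ s := Nat.cast_nonneg s; linarith) (one_le_pow₀ B.gens.one_le_M)
  have hM0 : (0 : ℝ) ≤ B.M := zero_le_one.trans B.gens.one_le_M
  have hsM : ((s : ℝ) + 1) * B.M ^ (s + 1) ≤ W * B.bigConst ^ (S₁ + 1) := by
    have hsS : (s : ℝ) ≤ S₁ := by exact_mod_cast hs
    have h1 : (s : ℝ) + 1 ≤ W := by linarith
    have h2 : B.M ^ (s + 1) ≤ B.bigConst ^ (S₁ + 1) :=
      (pow_le_pow_left₀ hM0 hM _).trans (pow_le_pow_right₀ hG1 (by omega))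
    exact mul_le_mul h1 h2 (pow_nonneg hM0 _) hW0
  have hsM0 : (0 : ℝ) ≤ ((s : ℝ) + 1) * B.M ^ (s + 1) := mul_nonneg (by positivity) (pow_nonneg hM0 _)
  have f8 : (((s : ℝ) + 1) * B.M ^ (s + 1)) ^ (D * B.hdeg + 2 * k) ≤ (W * B.bigConst ^ (S₁ + 1)) ^ P₁ :=
    (pow_le_pow_left₀ hsM0 hsM _).trans (pow_le_pow_right₀ (by
      calc (1 : ℝ) ≤ ((s : ℝ) + 1) * B.M ^ (s + 1) := hsM1
        _ ≤ W * B.bigConst ^ (S₁ + 1) := hsM) (by rw [hP₁]; omega))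
  -- nonnegativity
  have n1 : (0 : ℝ) ≤ (B.dd : ℝ) ^ k := by positivity
  have n2 : (0 : ℝ) ≤ (k : ℝ) ^ k := by positivity
  have n3 : (0 : ℝ) ≤ (Fintype.card (UIdx β γ δ D') : ℝ) := Nat.cast_nonneg _
  have n4 : (0 : ℝ) ≤ B.houseXi ξ := zero_le_one.trans (B.one_le_houseXi ξ)
  have n5 : (0 : ℝ) ≤ (((D * B.hdeg : ℕ) : ℝ) + 2 * k) ^ k := by positivity
  have n6 : (0 : ℝ) ≤ B.qB ^ k := pow_nonneg B.qB_nonneg _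
  have n7 : (0 : ℝ) ≤ B.hB ^ D := pow_nonneg (zero_le_one.trans B.one_le_hB) _
  have n8 : (0 : ℝ) ≤ (((s : ℝ) + 1) * B.M ^ (s + 1)) ^ (D * B.hdeg + 2 * k) := pow_nonneg hsM0 _
  unfold lineValBound
  rw [← hn, ← hD]
  calc (B.dd : ℝ) ^ k * (k : ℝ) ^ k * (Fintype.card (UIdx β γ δ D') : ℝ) * B.houseXi ξ *
        ((((D * B.hdeg : ℕ) : ℝ) + 2 * k) ^ k * B.qB ^ k * B.hB ^ D *
          (((s : ℝ) + 1) * B.M ^ (s + 1)) ^ (D * B.hdeg + 2 * k))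
      ≤ B.bigConst ^ T' * W ^ T' * W ^ n * (B.bigConst ^ 3 * W ^ (2 * n) * A) *
          (W ^ T' * B.bigConst ^ T' * B.bigConst ^ D * (W * B.bigConst ^ (S₁ + 1)) ^ P₁) := by
        refine mul_le_mul (mul_le_mul (mul_le_mul (mul_le_mul f1 f2 n2 (by positivity)) hU n3 (by positivity))
          hHξ n4 (by positivity)) (mul_le_mul (mul_le_mul (mul_le_mul f5 f6 n6 (by positivity)) f7 n7
          (by positivity)) f8 n8 (by positivity)) (by positivity) (by positivity)
    _ = B.bigConst ^ (2 * T' + 3 + D + (S₁ + 1) * P₁) * W ^ (2 * T' + 3 * n + P₁) * A := by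
        rw [mul_pow, ← pow_mul]; ring

omit [DecidableEq β] [DecidableEq δ] in
/-- **The saving factor of the spaced zeros**: if `2(S₁ + ℓS₀)/R ≤ θ ≤ 1` then for `s ≤ S₁`,
`k ≤ T'`, `(2(s+ℓS₀)/R)^{(T-k)(S₀+1)} ≤ θ^{(T-T')(S₀+1)}`. [folklore] -/
theorem saving_le₃ {ℓ S₀ S₁ T T' : ℕ} {R θ : ℝ} (hR : 0 < R) (hθ : 2 * ((S₁ : ℝ) + ℓ * S₀) / R ≤ θ)
    (hθ1 : θ ≤ 1) {s k : ℕ} (hs : s ≤ S₁) (hk : k ≤ T') :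
    (2 * ((s : ℝ) + ℓ * S₀) / R) ^ ((T - k) * (S₀ + 1)) ≤ θ ^ ((T - T') * (S₀ + 1)) := by
  have hb0 : 0 ≤ 2 * ((s : ℝ) + ℓ * S₀) / R := by positivity
  have hb : 2 * ((s : ℝ) + ℓ * S₀) / R ≤ θ := by
    refine le_trans (div_le_div_of_nonneg_right ?_ hR.le) hθ
    have : (s : ℝ) ≤ S₁ := by exact_mod_cast hs
    linarith
  have hθ0 : 0 ≤ θ := hb0.trans hb
  calc (2 * ((s : ℝ) + ℓ * S₀) / R) ^ ((T - k) * (S₀ + 1)) ≤ θ ^ ((T - k) * (S₀ + 1)) := pow_le_pow_left₀ hb0 hb _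
    _ ≤ θ ^ ((T - T') * (S₀ + 1)) := pow_le_pow_of_le_one hθ0 hθ1 (Nat.mul_le_mul_right _ (by omega))

end BakerData

end Std

end GaGmE

end Literature.NumberTheory.Transcendental

end
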